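import Summits.HodgeConjecture.CorCM.Census.OcticDecicWeilGDefect
import HarnessLib

/-!
# `E × B₄ × B₅` with `B₄` a CM fourfold of WEIL TYPE (`k`-signature `(2,2)`) over an octic and `B₅` a `(2,3)`-fivefold over a decic CM field
# sharing `k`, THROUGH THE MULTI-FIELD WEIL ENGINE: the data of the generic model (a slot of curve multiplicity `c = 0`) and THE DEFECT LAW
# `d₂ ≡ t₂, d₃ ≡ t₃, e = t₃` from a realised ROTATION of the five decic pairs and ORDERED `2`-TRANSITIVITY on the four octic pairs

COR-CM (cell `pub-hodgecm2`), seat b30 gen 29 (2026-08-24); count-neutral own lane (stem `OcticDecicWeil*`), the `(2,2) + (2,3)` companion of gen 28ʼs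
`Census/OcticDecicWeilGDefect.lean` (`(1,3) + (2,3)`), whose tuple readings `oc2`, `dc2`, `withDc2`, `rd0₂`, `rd1₂`, `mem_of_rot2` and pair numbers
`n2 = (4, 5)` are reused BY NAME.  Theorems of the finite model plus bookkeeping definitions (`np22`, `c22`, `w22`, `P22`); no named fact, no geometry,
no `sorry`, no `decide` beyond closed numerals.

THE INSTANCE.  `r = 2` fields: `K₂` octic (`n = 4` pairs, `k`-signature `(2,2)` read at `{0,1}`, curve multiplicity `c = 4 − 2·2 = 0`, `w = 2`: the Weil part is
the FOURFOLD `B₄` ITSELF), `K₃` decic (`n = 5`, `(2,3)` at `{0,1}`, `c = 1`, `w = 3`: the SIXFOLD `B₅ × E`).  THE ARGUMENT.  (i) Rotation-stability of the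
decic component (`hrot`, realised downstream with NO Galois hypothesis) forces `d₃ ≡ t₃` (`SexticDecicWeil.const_of_pairSums`) and a decic part `−t₃`;
(ii) ORDERED `2`-TRANSITIVITY on the octic pairs (`h2t`: some tuple moves any ordered pair `(x, y)`, `x ≠ y`, to `(0, 1)` — downstream: `Aut(ℂ/k)`
`2`-transitive on the four embeddings over `τ`, automatic when `B₄` is simple by Dodson) makes the pair sums `d₂ x + d₂ y` (`x ≠ y`) all equal, hence
(four points) `d₂ ≡ t₂`, and then `e = 4t₂ − 4t₂ + t₃ = t₃ = Σ_m c_m t_m`.  Without (ii) the law FAILS (a `D₄` quartic part with an edge type carries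
the alternating defect `(1,−1,1,−1)`): the `2`-transitivity hypothesis is not idle.
[cite: Pohlmann1968, Thm 1] [cite: GaoUllmo2025, Thm 3.1] [cite: MoonenZarhin1995Duke, Thm. 2.4] [cite: Dodson1984, §3.3.2 Theorem] [cite: DixonMortimer1996, §2.1]

## References
* [Pohlmann1968] H. Pohlmann, Ann. of Math. 88 (1968), Thm 1.  [GaoUllmo2025] Z. Gao, E. Ullmo, J. Inst. Math. Jussieu 25 (2025), Thm 3.1.
  [MoonenZarhin1995Duke] B. Moonen, Yu. Zarhin, Duke Math. J. 77 (1995), Thm. 2.4.  [Dodson1984] B. Dodson, Trans. AMS 283 (1984), §3.3.2 Theorem.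
  [DixonMortimer1996] J. D. Dixon, B. Mortimer, *Permutation Groups*, GTM 163, §2.1.
-/

namespace Summit.HodgeConjecture.CorCM.Census.OcticDecicWeil22

open Finset
open Summit.HodgeConjecture.CorCM.Census.MultiFieldWeil
open Summit.HodgeConjecture.CorCM.Census.OcticDecicWeilG
open Summit.HodgeConjecture.CorCM.Census.SexticDecicWeil (sum_ite_pair_eq const_of_pairSums sum_ite_rot_pow_eq)

/-! ### The data of the instance (pair numbers `n2 = (4, 5)` as in `Census/OcticDecicWeilGDefect`) -/

/-- Numbers of positions over `τ`: `2, 2` (`k`-signatures `(2,2)`, `(2,3)`). [folklore] -/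
def np22 : Fin 2 → ℕ := ![2, 2]

/-- Curve multiplicities `c_m = n_m − 2 p_m`: `0, 1` (the Weil parts `B₄` and `B₅ × E`). [folklore] -/
def c22 : Fin 2 → ℕ := ![0, 1]

/-- Part sizes `w_m = n_m − p_m`: `2, 3` (a fourfold and a sixfold). [folklore] -/
def w22 : Fin 2 → ℕ := ![2, 3]

/-- The position sets: the first `np22 m` positions, i.e. `{0, 1}` in both slots. [folklore] -/
def P22 : ∀ m : Fin 2, Finset (Fin (n2 m)) := fun m => lowPos (n2 m) (np22 m)

/-- `|P22 m| = np22 m`. [folklore] -/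
theorem card_P22 (m : Fin 2) : (P22 m).card = np22 m := by
  refine Fin.cases ?_ (fun m => Fin.cases ?_ (fun m => m.elim0) m) m
  · exact card_lowPos (by decide)
  · exact card_lowPos (by decide)

/-- `n_m = 2 p_m + c_m`. [folklore] -/
theorem n2_eq22 (m : Fin 2) : (n2 m : ℤ) = 2 * (P22 m).card + c22 m := by
  rw [card_P22]
  refine Fin.cases ?_ (fun m => Fin.cases ?_ (fun m => m.elim0) m) m <;> rfl

/-- `n_m + c_m = 2 w_m`. [folklore] -/
theorem n2_add_c22 (m : Fin 2) : n2 m + c22 m = 2 * w22 m := by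
  refine Fin.cases ?_ (fun m => Fin.cases ?_ (fun m => m.elim0) m) m <;> rfl

/-- `c_m < n_m`. [folklore] -/
theorem c22_lt_n2 (m : Fin 2) : c22 m < n2 m := by
  refine Fin.cases ?_ (fun m => Fin.cases ?_ (fun m => m.elim0) m) m <;> decide

/-! ### Reading the signed equation in concrete types -/

/-- **A permutation of `Fin 4` takes the values `0`, `1` exactly once each**: `Σ_a (σ a ∈ {0,1} ? f a : −f a) = 2 (f p + f q) − Σ f` when `σ p = 0`,
`σ q = 1` (the four-point twin of `SexticDecicWeil.sum_ite_pair_eq`). [folklore] -/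
theorem sum_ite_pair_eq₄ (σ : Equiv.Perm (Fin 4)) {p q : Fin 4} (hp : σ p = 0) (hq : σ q = 1) (f : Fin 4 → ℤ) :
    ∑ a : Fin 4, (if (σ a = 0 ∨ σ a = 1) then f a else -f a) = 2 * (f p + f q) - ∑ a : Fin 4, f a := by
  have hpq : p ≠ q := fun h => by
    rw [h, hq] at hp
    exact absurd hp (by decide)
  have key : ∀ a : Fin 4, (if (σ a = 0 ∨ σ a = 1) then f a else -f a) =
      ((if a = p then 2 * f a else 0) + (if a = q then 2 * f a else 0)) - f a := by
    intro a
    by_cases ha : a = p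
    · rw [if_pos (Or.inl (by rw [ha, hp])), if_pos ha, if_neg (fun h => hpq (ha.symm.trans h))]; ring
    · by_cases hb : a = q
      · rw [if_pos (Or.inr (by rw [hb, hq])), if_neg ha, if_pos hb]; ring
      · have h' : ¬ (σ a = 0 ∨ σ a = 1) := by
          rintro (h | h)
          · exact ha (σ.injective (h.trans hp.symm))
          · exact hb (σ.injective (h.trans hq.symm))
        rw [if_neg h', if_neg ha, if_neg hb]; ring
  rw [Finset.sum_congr rfl fun a _ => key a, Finset.sum_sub_distrib, Finset.sum_add_distrib, Finset.sum_ite_eq' Finset.univ p,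
    Finset.sum_ite_eq' Finset.univ q, if_pos (Finset.mem_univ p), if_pos (Finset.mem_univ q)]
  ring

/-- **The double sum of the signed equation, read in concrete types**: the conditions are `oc2 π a ∈ {0, 1}`, `dc2 π b ∈ {0, 1}`. [folklore] -/
theorem sum22_eq (π : PermsG n2) (d : ∀ m : Fin 2, Fin (n2 m) → ℤ) :
    (∑ m : Fin 2, ∑ a : Fin (n2 m), (if π m a ∈ P22 m then d m a else -d m a)) =
      (∑ a : Fin 4, (if (oc2 π a = 0 ∨ oc2 π a = 1) then rd0₂ d a else -rd0₂ d a)) +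
        ∑ b : Fin 5, (if (dc2 π b = 0 ∨ dc2 π b = 1) then rd1₂ d b else -rd1₂ d b) := by
  rw [Fin.sum_univ_two]
  have h0 : (∑ a : Fin (n2 0), (if π 0 a ∈ P22 0 then d 0 a else -d 0 a)) =
      ∑ a : Fin 4, (if (oc2 π a = 0 ∨ oc2 π a = 1) then rd0₂ d a else -rd0₂ d a) := by
    show (∑ a : Fin 4, (if oc2 π a ∈ lowPos 4 2 then rd0₂ d a else -rd0₂ d a)) = _
    exact Finset.sum_congr rfl fun a _ => if_congr mem_lowPos_two rfl rfl
  have h1 : (∑ a : Fin (n2 1), (if π 1 a ∈ P22 1 then d 1 a else -d 1 a)) =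
      ∑ b : Fin 5, (if (dc2 π b = 0 ∨ dc2 π b = 1) then rd1₂ d b else -rd1₂ d b) := by
    show (∑ b : Fin 5, (if dc2 π b ∈ lowPos 5 2 then rd1₂ d b else -rd1₂ d b)) = _
    exact Finset.sum_congr rfl fun a _ => if_congr mem_lowPos_two rfl rfl
  rw [h0, h1]

/-! ### The defect law -/

section Defect

variable {R : Finset (PermsG n2)}

/-- **THE DEFECT LAW (integer form) for a `(2,2)`-octic and a `(2,3)`-decic slot.**  If `e` and `d` satisfy the signed equation at every tuple of a set `R`
that is stable under right translation of the decic component by a conjugate rotation (`hrot`) and moves every ORDERED pair of distinct octic pairs to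
`(0, 1)` (`h2t`), then `d_m ≡ t_m` are constant and `e = t₃ = 0·t₂ + 1·t₃`. [cite: MoonenZarhin1995Duke, Thm. 2.4] [cite: GaoUllmo2025, Thm 3.1] -/
theorem defect22_of_signed (g : Equiv.Perm (Fin 5)) (hrot : ∀ π ∈ R, withDc2 π (dc2 π * (g * finRotate 5 * g⁻¹)) ∈ R)
    (h2t : ∀ x y : Fin 4, x ≠ y → ∃ π ∈ R, oc2 π x = 0 ∧ oc2 π y = 1) {e : ℤ} {d : ∀ m : Fin 2, Fin (n2 m) → ℤ}
    (h : ∀ π ∈ R, e + ∑ m : Fin 2, ∑ a : Fin (n2 m), (if π m a ∈ P22 m then d m a else -d m a) = 0) :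
    ∃ t : Fin 2 → ℤ, (∀ (m : Fin 2) (a : Fin (n2 m)), d m a = t m) ∧ e = ∑ m : Fin 2, (c22 m : ℤ) * t m := by
  set d₂ : Fin 4 → ℤ := rd0₂ d with hd₂
  set d₃ : Fin 5 → ℤ := rd1₂ d with hd₃
  have h' : ∀ π ∈ R, e + ((∑ a : Fin 4, (if (oc2 π a = 0 ∨ oc2 π a = 1) then d₂ a else -d₂ a)) +
      ∑ b : Fin 5, (if (dc2 π b = 0 ∨ dc2 π b = 1) then d₃ b else -d₃ b)) = 0 := by
    intro π hπ
    have h1 := h π hπ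
    rw [sum22_eq] at h1
    exact h1
  -- (i) the decic slot: rotations of ONE tuple force `d₃` constant
  obtain ⟨π₀, hπ₀, -⟩ := h2t 0 1 (by decide)
  set π₃ : Equiv.Perm (Fin 5) := dc2 π₀ with hπ₃
  set u : Fin 5 → ℤ := fun c => d₃ (g c) with hu
  have hp : (π₃ * g) ((π₃ * g).symm 0) = 0 := (π₃ * g).apply_symm_apply 0
  have hq : (π₃ * g) ((π₃ * g).symm 1) = 1 := (π₃ * g).apply_symm_apply 1
  have hpq : (π₃ * g).symm 0 ≠ (π₃ * g).symm 1 := fun hh => by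
    have h'' := congrArg (π₃ * g) hh
    rw [hp, hq] at h''
    exact absurd h'' (by decide)
  have hrotj : ∀ j : Fin 5, e + ((∑ a : Fin 4, (if (oc2 π₀ a = 0 ∨ oc2 π₀ a = 1) then d₂ a else -d₂ a)) +
      ∑ b : Fin 5, (if ((π₃ * (g * finRotate 5 * g⁻¹) ^ (j : ℕ)) b = 0 ∨ (π₃ * (g * finRotate 5 * g⁻¹) ^ (j : ℕ)) b = 1)
        then d₃ b else -d₃ b)) = 0 := by
    intro j
    have h1 := h' _ (mem_of_rot2 g hrot hπ₀ (j : ℕ))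
    rw [oc2_withDc2, dc2_withDc2] at h1
    exact h1
  have hS : ∀ j : Fin 5, u ((π₃ * g).symm 0 - j) + u ((π₃ * g).symm 1 - j) = u ((π₃ * g).symm 0) + u ((π₃ * g).symm 1) := by
    intro j
    have h0 := hrotj 0
    have hj := hrotj j
    rw [sum_ite_rot_pow_eq π₃ g d₃ 0 hp hq, sub_zero, sub_zero] at h0
    rw [sum_ite_rot_pow_eq π₃ g d₃ j hp hq] at hj
    simp only [hu]
    linarith
  have huc : ∀ c, u c = u ((π₃ * g).symm 0) := const_of_pairSums hpq hS
  set t₃ : ℤ := d₃ (g ((π₃ * g).symm 0)) with ht₃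
  have hd₃c : ∀ b, d₃ b = t₃ := fun b => by
    have h1 := huc (g.symm b)
    simp only [hu, Equiv.apply_symm_apply] at h1
    exact h1
  have hB : ∀ σ : Equiv.Perm (Fin 5), (∑ b : Fin 5, (if (σ b = 0 ∨ σ b = 1) then d₃ b else -d₃ b)) = -t₃ := by
    intro σ
    rw [sum_ite_pair_eq σ (σ.apply_symm_apply 0) (σ.apply_symm_apply 1) d₃, Finset.sum_congr rfl fun b _ => hd₃c b,
      hd₃c (σ.symm 0), hd₃c (σ.symm 1), Finset.sum_const, Finset.card_univ, Fintype.card_fin]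
    ring
  -- (ii) the octic slot: all pair sums `d₂ x + d₂ y`, `x ≠ y`, are equal
  have heq : ∀ x y : Fin 4, x ≠ y → e + (2 * (d₂ x + d₂ y) - ∑ a, d₂ a) - t₃ = 0 := by
    intro x y hxy
    obtain ⟨π, hπ, hx, hy⟩ := h2t x y hxy
    have h1 := h' π hπ
    rw [sum_ite_pair_eq₄ (oc2 π) hx hy d₂, hB (dc2 π)] at h1
    linarith
  have hkey : ∀ a b c : Fin 4, a ≠ c → b ≠ c → d₂ a = d₂ b := by
    intro a b c hac hbc
    have h1 := heq a c hac
    have h2 := heq b c hbc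
    linarith
  have hthird : ∀ a : Fin 4, ∃ c : Fin 4, a ≠ c ∧ (0 : Fin 4) ≠ c := by decide
  have hd₂c : ∀ a, d₂ a = d₂ 0 := fun a => by
    obtain ⟨c, hac, h0c⟩ := hthird a
    exact hkey a 0 c hac h0c
  refine ⟨![d₂ 0, t₃], fun m => ?_, ?_⟩
  · refine Fin.cases ?_ (fun m => Fin.cases ?_ (fun m => m.elim0) m) m
    · exact fun a => hd₂c a
    · exact fun a => hd₃c a
  · have hs₂ : ∑ a, d₂ a = 4 * d₂ 0 := by
      rw [Finset.sum_congr rfl fun a _ => hd₂c a, Finset.sum_const, Finset.card_univ, Fintype.card_fin]; ring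
    have h3 := heq 0 1 (by decide)
    rw [hs₂, hd₂c 1] at h3
    rw [Fin.sum_univ_two]
    show e = ((0 : ℕ) : ℤ) * d₂ 0 + ((1 : ℕ) : ℤ) * t₃
    push_cast
    linarith

end Defect

/-! ### The defect law for configurations -/

section Config

variable {α : Type*} {R : Finset (PermsG n2)} {v : α → PtG n2}

/-- **THE DEFECT LAW FOR CONFIGURATIONS (a `(2,2)`-octic and a `(2,3)`-decic slot).**  An `R`-balanced configuration, `R` rotation-stable on the decic
pairs and ordered-`2`-transitive on the octic pairs, obeys the defect law of the generic model with curve multiplicities `c22 = (0, 1)` — the hypothesis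
`hdef` of `MultiFieldWeil.hodgeConjectureFor_biproduct_comp_of_defectLawG`. [cite: MoonenZarhin1995Duke, Thm. 2.4] [cite: GaoUllmo2025, Thm 3.1] -/
theorem exists_hasDefectsG_of_modelBalancedG22 (g : Equiv.Perm (Fin 5))
    (hrot : ∀ π ∈ R, withDc2 π (dc2 π * (g * finRotate 5 * g⁻¹)) ∈ R) (h2t : ∀ x y : Fin 4, x ≠ y → ∃ π ∈ R, oc2 π x = 0 ∧ oc2 π y = 1)
    {T : Finset α} (hT : ModelBalancedG P22 R v T) : ∃ t : Fin 2 → ℤ, HasDefectsG c22 v T t := by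
  obtain ⟨t, hd, he⟩ := defect22_of_signed g hrot h2t (e := (cnt v T (Sum.inl true) : ℤ) - cnt v T (Sum.inl false))
    (d := fun m a => (cnt v T (Sum.inr ⟨m, (a, true)⟩) : ℤ) - cnt v T (Sum.inr ⟨m, (a, false)⟩))
    fun π hπ => signed_of_modelBalancedG R v hT hπ
  exact ⟨t, fun m a => hd m a, he⟩

/-- **The balance at every tuple follows** (the law makes the configuration balanced under ALL tuples — used for the ordered-pair bookkeeping downstream).
[folklore] -/
theorem modelBalancedG22_of_rot (g : Equiv.Perm (Fin 5))
    (hrot : ∀ π ∈ R, withDc2 π (dc2 π * (g * finRotate 5 * g⁻¹)) ∈ R) (h2t : ∀ x y : Fin 4, x ≠ y → ∃ π ∈ R, oc2 π x = 0 ∧ oc2 π y = 1)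
    {T : Finset α} (hT : ModelBalancedG P22 R v T) (R' : Finset (PermsG n2)) : ModelBalancedG P22 R' v T := by
  obtain ⟨t, ht⟩ := exists_hasDefectsG_of_modelBalancedG22 g hrot h2t hT
  exact modelBalancedG_of_hasDefects n2_eq22 ht R'

end Config

end Summit.HodgeConjecture.CorCM.Census.OcticDecicWeil22
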